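/-
Copyright (c) 2026 the pub-hodgecm-mathlib formalisation cell (harness21).  Prover seat hodgecm-mathlib-K2E1-p14 (g2), Track B «K2-LIT» ENGINE E1, h413 =
`stmt-HodgeConjecture-24833`, route `HCCMUnconditional`, 5Res ROADCARD §3′ D4′c (SD) AT M1 — THE LETTER-FREE PRINT: ★ p861041 (the plug on the pinned package) ∘ ★ p861074 (`hB`)
∘ ★ p860947 (`hSD`) ∘ ★ p860788 (the package): the Plancherel isometry of the rank-one self-dual block at the maximal level, STRUCTURAL BINDERS ONLY.
-/
import Summits.HodgeConjecture.HodgeConjecture.Theorems.K2E1ChiSectionPlancherelSelfDualM1CMTwoComplete   -- ★ p861041 (this seat): `exists_linearIsometry_chiSection_selfDual_m1_cm_two_of_package` (+ ★ p860788 the package)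
import Summits.HodgeConjecture.HodgeConjecture.Theorems.K2E1ChiScatteringStripBoundOfPackageM1CMTwo      -- ★ p861074 (this seat): `hB_of_package_m1_cm_two`
import Summits.HodgeConjecture.HodgeConjecture.Theorems.K2E1ChiSectionPlancherelSDGramLetterM1CMTwo       -- ★ p860947 (K2E3-p12): `hSD_m1_cm_two`
import HarnessLib

/-!
# D4′c (SD) at M1, LETTER-FREE — `K2E1ChiSectionPlancherelSelfDualM1CMTwoLetterFree`: THE PLANCHEREL ISOMETRY OF THE RANK-ONE SELF-DUAL `χ`-BLOCK OF `U(1,1)_{L∕L⁺}` AT THE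
# MAXIMAL LEVEL (`K′ = K_max`, `ω = 1`), ALL (SD) LETTERS DISCHARGED

Track B ∕ K2-LIT, crux h413 = `stmt-HodgeConjecture-24833`, route of record `HCCMUnconditional`; cell `hodgecm-mathlib`, squad K2, ENGINE E1.  THEOREMS ONLY (no `def`, no `instance`,
no `notation`, no named-fact hypothesis, no `sorry`; default heartbeats); lane `--supports stmt-HodgeConjecture-24833 --as helper` (count-neutral).

THE MATHEMATICS ([MoeglinWaldspurger1995, II.2.4, IV.1.10–IV.1.11, IV.3.12]; [Langlands1976, §7]; [Iwaniec2002, §7.3]).  For a CM field `L`, a self-dual unitary Hecke character `χ`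
trivial on `ℝ_{>0}`, and a normalised section `φ ∈ V(χ, K_max, 1)` (continuous, bounded, `φ ∘ ι_∞ = φ(1)`, `φ(1) ≠ 0` real) — the rank-one block: every section at the maximal level is
`c•φ` — the classes `y_{i,a} = [θ_{f_{i,a}, c_a•φ}] ∈ L²(X, μ)` of the pure tensors (`f_{i,a} ∈ C²_c((0,∞))`, `c_a ≠ 0`) span a space whose closure is ISOMETRIC to
`(⊕_{c∈S} W) ⊕₂ L²((0,∞); W)`, `W = ℂ·[φ|_{K_max}] ≤ L²(K_max)`: `U (Σ_a y_{i,a}) = (r′_i, √(C∕2π)•w_i)` with `⟪r′_i, r′_j⟫ = C·Σ_{c∈S} ⟪Ψ̂_i(−c), ρ_c•Ψ̂_j(−c)⟫_W`, `w_i(t) =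
Ψ̂_i(−(½+it)) + s(½−it)•Ψ̂_i(−(½−it))`, where `s` is the rank-one scattering scalar (Godement-range formula, meromorphic in normal form, analytic off a closed `P ⊆ {Re ≤ 1}`), `S ⊂ (½, σ₀)`
its genuine real poles and `ρ_c ≥ 0` its residues.  ASSEMBLY: the package of ★ `chi_scattering_real_poles_m1_complete_cm_two` (ONE `obtain`), then ★ p861041
`exists_linearIsometry_chiSection_selfDual_m1_cm_two_of_package` with `hB` := ★ p861074 `hB_of_package_m1_cm_two` and `hSD` := ★ p860947 `hSD_m1_cm_two` (the sections `c_a•φ` are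
`χ`-sections, continuous, bounded, right-`K_max`-invariant, non-degenerate; the tube formula of `s` for the datum `c_a•φ` is that for `φ` by linearity; `s(conj z) = conj s(z)` on the tube by ★
p860445).
* §1 `tube_formula_smul` (the Godement-range formula is homogeneous of degree `0` in the datum).  * §2 `exists_linearIsometry_chiSection_selfDual_m1_rankOne_of_package` (on the package
  clauses; `hB`, `hSD` discharged).  * §3 HEAD **`exists_linearIsometry_chiSection_selfDual_m1_letterFree_cm_two`** — STRUCTURAL BINDERS ONLY; the SD-block input of the RUNG-1 package
  (K2E4-p23) BY NAME.
HONEST LABEL: HC_CM is proved only modulo the 7 printed citations (2 remaining named inputs: hLiu418 = `stmt-HodgeConjecture-24832`, h413 = `stmt-HodgeConjecture-24833`) until rung 0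
closes; this file asserts no named fact, closes no socket; count-neutral; NO letters beyond the structural data of the M1 datum.

## References
* [MoeglinWaldspurger1995] C. Mœglin, J.-L. Waldspurger, *Spectral decomposition and Eisenstein series* (1995), II.2.4, IV.1.10–IV.1.11, IV.3.12.
* [Langlands1976] R. P. Langlands, *On the Functional Equations Satisfied by Eisenstein Series*, LNM 544 (1976), §7.
* [Iwaniec2002] H. Iwaniec, *Spectral Methods of Automorphic Forms* (2nd ed., 2002), §7.3.
-/

set_option autoImplicit false
set_option linter.dupNamespace false  -- the mandated namespace repeats the summit's segment (`HodgeConjecture.HodgeConjecture`)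

noncomputable section

open MeasureTheory MeasureTheory.Measure Set NumberField IsDedekindDomain Filter Topology Complex
open scoped Real NNReal ENNReal ComplexConjugate InnerProductSpace BigOperators
open Literature.MeasureTheory.Group Literature.NumberTheory
open Literature.NumberTheory.Automorphic Literature.NumberTheory.Automorphic.UnitaryGroup AdelicGroupData
open Literature.NumberTheory.GaloisRepresentations
open Summit.HodgeConjecture.HodgeConjecture.Cruxes.H413.K2E1BorelEisensteinU
open Summit.HodgeConjecture.HodgeConjecture.Cruxes.H413.K2E1BLBorelSpacesU2Defs
open Summit.HodgeConjecture.HodgeConjecture.Cruxes.H413.K2E1BLBorelOperatorsU2Defs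
open Summit.HodgeConjecture.HodgeConjecture.Cruxes.H413.K2E1CharacterEisensteinU2Defs
open Summit.HodgeConjecture.HodgeConjecture.Cruxes.H413.K2E1ChiSectionSpaceU2Defs
open Summit.HodgeConjecture.HodgeConjecture.Cruxes.H413.K2E1ChiSectionPlancherelSelfDualM1CMTwoComplete (exists_linearIsometry_chiSection_selfDual_m1_cm_two_of_package)
open Summit.HodgeConjecture.HodgeConjecture.Cruxes.H413.K2E1ChiScatteringStripBoundOfPackageM1CMTwo (hB_of_package_m1_cm_two)
open Summit.HodgeConjecture.HodgeConjecture.Cruxes.H413.K2E1ChiSectionPlancherelSDGramLetterM1CMTwo (hSD_m1_cm_two)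
open Summit.HodgeConjecture.HodgeConjecture.Cruxes.H413.K2E1ChiScatteringRealPolesM1CMTwoComplete (chi_scattering_real_poles_m1_complete_cm_two)
open Summit.HodgeConjecture.HodgeConjecture.Cruxes.H413.K2E1ChiScatteringConjSymmetryM1CMTwo (chi_scattering_conj_symm_m1_cm_two exists_galTwist_cm)
open Summit.HodgeConjecture.HodgeConjecture.Cruxes.H413.K2E1PlancherelIsometryOfForm (mem_topologicalClosure_span)

namespace Summit.HodgeConjecture.HodgeConjecture.Cruxes.H413.K2E1ChiSectionPlancherelSelfDualM1CMTwoLetterFree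

variable (L : Type) [Field L] [NumberField L] [IsCMField L]
variable [MeasurableSpace (quasiSplit (↥(maximalRealSubfield L)) L (IsCMField.complexConj L) 2).Adelic] [BorelSpace (quasiSplit (↥(maximalRealSubfield L)) L (IsCMField.complexConj L) 2).Adelic]
variable [MeasurableSpace (AdeleRing (𝓞 L) L)ˣ] [BorelSpace (AdeleRing (𝓞 L) L)ˣ]

/-! ## §1 The Godement-range formula is homogeneous of degree 0 in the datum -/

omit [BorelSpace (quasiSplit (↥(maximalRealSubfield L)) L (IsCMField.complexConj L) 2).Adelic] [MeasurableSpace (AdeleRing (𝓞 L) L)ˣ] [BorelSpace (AdeleRing (𝓞 L) L)ˣ] in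
/-- **The tube formula of the scattering scalar for the datum `c•φ` is that for `φ`** (`c ≠ 0`): `r·((c•φ)(1))⁻¹·∫ f_z^{c•φ}(w₀ v) dν = r·(φ 1)⁻¹·∫ f_z^φ(w₀ v) dν` — the flat section
is linear in the datum. [cite: MoeglinWaldspurger1995, II.1.7] -/
theorem tube_formula_smul (ν : Measure ↥(adelicUnipotent (↥(maximalRealSubfield L)) L (IsCMField.complexConj L) 2))
    {φ : (quasiSplit (↥(maximalRealSubfield L)) L (IsCMField.complexConj L) 2).Adelic → ℂ} {c : ℂ} (hc : c ≠ 0) (r : ℂ) (z : ℂ) :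
    r * (((c • φ) 1)⁻¹ * ∫ v : ↥(adelicUnipotent (↥(maximalRealSubfield L)) L (IsCMField.complexConj L) 2), flatSectionU (c • φ) z
        ((quasiSplit (↥(maximalRealSubfield L)) L (IsCMField.complexConj L) 2).toAdelic (weylLongU ((IsCMField.complexConj L : L ≃ₐ[↥(maximalRealSubfield L)] L) : L →+* L)
          (rfl : (StdForm.antidiagonal 2).over L = (StdForm.antidiagonal 2).over L)) * ((v : (quasiSplit (↥(maximalRealSubfield L)) L (IsCMField.complexConj L) 2).Adelic) * 1)) ∂ν) =
    r * ((φ 1)⁻¹ * ∫ v : ↥(adelicUnipotent (↥(maximalRealSubfield L)) L (IsCMField.complexConj L) 2), flatSectionU φ z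
        ((quasiSplit (↥(maximalRealSubfield L)) L (IsCMField.complexConj L) 2).toAdelic (weylLongU ((IsCMField.complexConj L : L ≃ₐ[↥(maximalRealSubfield L)] L) : L →+* L)
          (rfl : (StdForm.antidiagonal 2).over L = (StdForm.antidiagonal 2).over L)) * ((v : (quasiSplit (↥(maximalRealSubfield L)) L (IsCMField.complexConj L) 2).Adelic) * 1)) ∂ν) := by
  have hI : (∫ v : ↥(adelicUnipotent (↥(maximalRealSubfield L)) L (IsCMField.complexConj L) 2), flatSectionU (c • φ) z
        ((quasiSplit (↥(maximalRealSubfield L)) L (IsCMField.complexConj L) 2).toAdelic (weylLongU ((IsCMField.complexConj L : L ≃ₐ[↥(maximalRealSubfield L)] L) : L →+* L)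
          (rfl : (StdForm.antidiagonal 2).over L = (StdForm.antidiagonal 2).over L)) * ((v : (quasiSplit (↥(maximalRealSubfield L)) L (IsCMField.complexConj L) 2).Adelic) * 1)) ∂ν) =
      c * ∫ v : ↥(adelicUnipotent (↥(maximalRealSubfield L)) L (IsCMField.complexConj L) 2), flatSectionU φ z
        ((quasiSplit (↥(maximalRealSubfield L)) L (IsCMField.complexConj L) 2).toAdelic (weylLongU ((IsCMField.complexConj L : L ≃ₐ[↥(maximalRealSubfield L)] L) : L →+* L)
          (rfl : (StdForm.antidiagonal 2).over L = (StdForm.antidiagonal 2).over L)) * ((v : (quasiSplit (↥(maximalRealSubfield L)) L (IsCMField.complexConj L) 2).Adelic) * 1)) ∂ν := by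
    rw [← integral_const_mul]
    refine integral_congr_ae (Eventually.of_forall fun v => ?_)
    simp only [flatSectionU_apply, Pi.smul_apply, smul_eq_mul, mul_assoc]
  rw [hI, Pi.smul_apply, smul_eq_mul, mul_inv, mul_mul_mul_comm, inv_mul_cancel₀ hc, one_mul]

/-! ## §2 The rank-one block on the package clauses: `hB`, `hSD` discharged -/

/-- **THE RANK-ONE SELF-DUAL BLOCK AT M1 ON THE PACKAGE CLAUSES, ALL LETTERS DISCHARGED.**  Binders: ★ p861041's package block; the rank-one pure tensors — scalars `c_a ≠ 0`,
`L²(K_max)`-representatives `v_a =ᵐ (c_a•φ)|_{K_max}`, test functions `f_{i,a} ∈ C²_c((0,∞))`, classes `y_{i,a} =ᵐ θ_{f_{i,a}, c_a•φ}`; `σ₀ > 1`.  `hB` := ★ `hB_of_package_m1_cm_two`;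
`hSD` := ★ `hSD_m1_cm_two` (sections `c_a•φ`: `χ`-sections by ★ `IsChiSection.smul`, right-`K_max`-invariant by ★ `apply_mul_of_mem`, tube formula by §1, `s(conj z) = conj s(z)` on the tube by ★
`chi_scattering_conj_symm_m1_cm_two`).  CONCLUSION: `∃ C S ρ r′ w U`, `0 < C` and ★ p861041's five clauses. [cite: MoeglinWaldspurger1995, II.2.4, IV.3.12] [cite: Langlands1976, §7] -/
theorem exists_linearIsometry_chiSection_selfDual_m1_rankOne_of_package
    (μ : Measure (quasiSplit (↥(maximalRealSubfield L)) L (IsCMField.complexConj L) 2).automorphicQuotient) [(quasiSplit (↥(maximalRealSubfield L)) L (IsCMField.complexConj L) 2).IsAutomorphicMeasure μ]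
    (νG : Measure (quasiSplit (↥(maximalRealSubfield L)) L (IsCMField.complexConj L) 2).Adelic) [νG.IsHaarMeasure] [νG.IsInvInvariant] [SFinite νG]
    (μK : Measure ↥((standardMaximalCompactGL 2 L).comap (adelicVal (↥(maximalRealSubfield L)) L (IsCMField.complexConj L) 2 ((StdForm.antidiagonal 2).over L)) : Subgroup (quasiSplit (↥(maximalRealSubfield L)) L (IsCMField.complexConj L) 2).Adelic)) [μK.IsHaarMeasure]
    (νI : Measure (AdeleRing (𝓞 L) L)ˣ) [νI.IsHaarMeasure]
    {𝓕I : Set (AdeleRing (𝓞 L) L)ˣ} (h𝓕I : IsIdeleClassDomain L 𝓕I)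
    (ν : Measure ↥(adelicUnipotent (↥(maximalRealSubfield L)) L (IsCMField.complexConj L) 2)) [ν.IsHaarMeasure] [ν.IsMulRightInvariant] [ν.IsInvInvariant]
    {𝓕 : Set ↥(adelicUnipotent (↥(maximalRealSubfield L)) L (IsCMField.complexConj L) 2)} (h𝓕N : IsFundamentalDomain ↥(rationalUnipotent (↥(maximalRealSubfield L)) L (IsCMField.complexConj L) 2) 𝓕 ν) (h𝓕1 : ν 𝓕 = 1)
    (h𝓕c : IsCompact (closure 𝓕))
    {β : (quasiSplit (↥(maximalRealSubfield L)) L (IsCMField.complexConj L) 2).Adelic → ℝ≥0∞} (hβ : IsCoveringWeight ↥((arithmeticBorel (↥(maximalRealSubfield L)) L (IsCMField.complexConj L) 2).map (quasiSplit (↥(maximalRealSubfield L)) L (IsCMField.complexConj L) 2).arithmeticSubgroup.subtype) β)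
    {μZ : Measure (borelQuotient (↥(maximalRealSubfield L)) L (IsCMField.complexConj L) 2)} [SFinite μZ]
    (hμZ : ∀ f : borelQuotient (↥(maximalRealSubfield L)) L (IsCMField.complexConj L) 2 → ℝ≥0∞, Measurable f → ∫⁻ z, f z ∂μZ = ∫⁻ g, β g * f (toBorelQuotient (↥(maximalRealSubfield L)) L (IsCMField.complexConj L) 2 g) ∂νG)
    {χ : HeckeCharacter L} (hχ : χ.IsUnitary) (hρ : ∀ r : ℝ≥0ˣ, χ (posRealIdele L r) = 1) (hsd : reflectChar (IsCMField.complexConj L) χ = χ)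
    {φ : (quasiSplit (↥(maximalRealSubfield L)) L (IsCMField.complexConj L) 2).Adelic → ℂ} (hφV : φ ∈ chiSectionSpace χ ((standardMaximalCompactGL 2 L).comap (adelicVal (↥(maximalRealSubfield L)) L (IsCMField.complexConj L) 2 ((StdForm.antidiagonal 2).over L)) : Subgroup (quasiSplit (↥(maximalRealSubfield L)) L (IsCMField.complexConj L) 2).Adelic) (fun _ => 1)) (hφc : Continuous φ) {Mφ : ℝ} (hφM : ∀ x, ‖φ x‖ ≤ Mφ)
    (hφinf : ∀ a : arch (↥(maximalRealSubfield L)) L (IsCMField.complexConj L) 2 ((StdForm.antidiagonal 2).over L), φ (archToAdelic (↥(maximalRealSubfield L)) L (IsCMField.complexConj L) 2 _ a) = φ 1)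
    (hφ1 : φ 1 ≠ 0) (hφ1r : conj (φ 1) = φ 1)
    {q qc : Unit → ℂ → ℂ} {Ec : ℂ → (quasiSplit (↥(maximalRealSubfield L)) L (IsCMField.complexConj L) 2).Adelic → ℂ} {P : Set ℂ}
    (hqφ : ∀ z : ℂ, 1 < z.re → (∑ j, q j z • φ) = ((((ν 𝓕).toReal⁻¹ : ℝ)) : ℂ) • (fun g : (quasiSplit (↥(maximalRealSubfield L)) L (IsCMField.complexConj L) 2).Adelic => (∫ v : ↥(adelicUnipotent (↥(maximalRealSubfield L)) L (IsCMField.complexConj L) 2), flatSectionU φ z ((quasiSplit (↥(maximalRealSubfield L)) L (IsCMField.complexConj L) 2).toAdelic (weylLongU ((IsCMField.complexConj L : L ≃ₐ[↥(maximalRealSubfield L)] L) : L →+* L) (rfl : (StdForm.antidiagonal 2).over L = (StdForm.antidiagonal 2).over L)) * ((v : (quasiSplit (↥(maximalRealSubfield L)) L (IsCMField.complexConj L) 2).Adelic) * g)) ∂ν) * (((borelHeight g : ℝ) : ℂ) ^ (z - 1))))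
    (hqNF : ∀ j, MeromorphicNFOn (qc j) univ) (hE1 : ∀ z : ℂ, 1 < z.re → Ec z = eisensteinSeriesU (flatSectionU φ z)) (hqcq : ∀ j (z : ℂ), 1 < z.re → qc j z = q j z)
    (hPc : IsClosed P) (hPcd : ∀ z₀ : ℂ, ∀ᶠ s in 𝓝[≠] z₀, s ∉ P) (hPre : ∀ z ∈ P, z.re ≤ 1) (hqa : ∀ j (z : ℂ), z ∉ P → AnalyticAt ℂ (qc j) z)
    (U : ℕ → Set ℂ) (hUo : ∀ n, IsOpen (U n)) (hUcod : ∀ n : ℕ, ∀ z₀ ∈ Metric.ball (0 : ℂ) (n + 2), ∀ᶠ s in 𝓝[≠] z₀, s ∈ U n)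
    (T₀ : ℕ → ℝ≥0) (hT₀ : ∀ n, 1 ≤ T₀ n) (Fam : ℕ → ℂ → Lp ℂ 2 μ) (hFd : ∀ n, DifferentiableOn ℂ (Fam n) (U n \ P))
    (hFam : ∀ n, ∀ z ∈ U n \ P, ((Fam n z : Lp ℂ 2 μ) : (quasiSplit (↥(maximalRealSubfield L)) L (IsCMField.complexConj L) 2).automorphicQuotient → ℂ) =ᵐ[μ] (quasiSplit (↥(maximalRealSubfield L)) L (IsCMField.complexConj L) 2).quotFun (truncation ν 𝓕 (T₀ n) (Ec z)))
    (hs_tube : ∀ z : ℂ, 1 < z.re → qc default z = (((ν 𝓕).toReal⁻¹ : ℝ) : ℂ) * ((φ 1)⁻¹ * ∫ v : ↥(adelicUnipotent (↥(maximalRealSubfield L)) L (IsCMField.complexConj L) 2), flatSectionU φ z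
        ((quasiSplit (↥(maximalRealSubfield L)) L (IsCMField.complexConj L) 2).toAdelic (weylLongU (IsCMField.complexConj L : L →+* L)
          (rfl : (StdForm.antidiagonal 2).over L = (StdForm.antidiagonal 2).over L)) * ((v : (quasiSplit (↥(maximalRealSubfield L)) L (IsCMField.complexConj L) 2).Adelic) * 1)) ∂ν))
    -- the rank-one pure tensors `f_{i,a} ⊗ (c_a•φ)`: scalars, `L²(K_max)`-representatives, test functions, classes
    {ι α : Type*} [Fintype α] (c : α → ℂ) (hc : ∀ a, c a ≠ 0)
    (v : α → Lp ℂ 2 μK) (hv : ∀ a, ((v a : Lp ℂ 2 μK) : ↥((standardMaximalCompactGL 2 L).comap (adelicVal (↥(maximalRealSubfield L)) L (IsCMField.complexConj L) 2 ((StdForm.antidiagonal 2).over L)) : Subgroup (quasiSplit (↥(maximalRealSubfield L)) L (IsCMField.complexConj L) 2).Adelic) → ℂ) =ᵐ[μK]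
      fun k => (c a • φ) (k : (quasiSplit (↥(maximalRealSubfield L)) L (IsCMField.complexConj L) 2).Adelic))
    {f : ι → α → ℝ → ℂ} (hf : ∀ i a, ContDiff ℝ 2 (f i a)) (hfs : ∀ i a, HasCompactSupport (f i a)) (hf0 : ∀ i a, tsupport (f i a) ⊆ Ioi 0)
    (y : ι → α → Lp ℂ 2 μ) (hy : ∀ i a, ((y i a : Lp ℂ 2 μ) : (quasiSplit (↥(maximalRealSubfield L)) L (IsCMField.complexConj L) 2).automorphicQuotient → ℂ) =ᵐ[μ]
      (quasiSplit (↥(maximalRealSubfield L)) L (IsCMField.complexConj L) 2).quotFun (eisensteinSeriesU (fun g : (quasiSplit (↥(maximalRealSubfield L)) L (IsCMField.complexConj L) 2).Adelic => f i a (borelHeight g : ℝ) * (c a • φ) g)))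
    {σ₀ : ℝ} (hσ₀ : 1 < σ₀) :
    ∃ (C : ℝ) (S : Finset ℝ) (ρ : ℝ → ℂ) (r' : ι → PiLp 2 (fun _ : ↥S => ↥(Submodule.span ℂ (Set.range v)))) (w : ι → Lp ↥(Submodule.span ℂ (Set.range v)) 2 ((volume : Measure ℝ).restrict (Ioi 0)))
      (Uiso : (Submodule.span ℂ (Set.range fun i => ∑ a, y i a)).topologicalClosure →ₗᵢ[ℂ]
        WithLp 2 (PiLp 2 (fun _ : ↥S => ↥(Submodule.span ℂ (Set.range v))) × Lp ↥(Submodule.span ℂ (Set.range v)) 2 ((volume : Measure ℝ).restrict (Ioi 0)))),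
      0 < C ∧
      (∀ c ∈ S, ¬ AnalyticAt ℂ (qc default) (c : ℂ) ∧ 1 / 2 < c ∧ c < σ₀) ∧
      (∀ c ∈ S, Tendsto (fun z : ℂ => (z - c) * qc default z) (𝓝[≠] (c : ℂ)) (𝓝 (ρ c)) ∧ (ρ c).im = 0 ∧ 0 ≤ (ρ c).re) ∧
      (∀ i j, ⟪r' i, r' j⟫_ℂ = (C : ℂ) * ∑ c ∈ S, ⟪∑ b, mellin (f i b) (-(c : ℂ)) • (⟨v b, Submodule.subset_span ⟨b, rfl⟩⟩ : ↥(Submodule.span ℂ (Set.range v))),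
        ρ c • ∑ a, mellin (f j a) (-(c : ℂ)) • (⟨v a, Submodule.subset_span ⟨a, rfl⟩⟩ : ↥(Submodule.span ℂ (Set.range v)))⟫_ℂ) ∧
      (∀ i, (w i : ℝ → ↥(Submodule.span ℂ (Set.range v))) =ᵐ[(volume : Measure ℝ).restrict (Ioi 0)] fun t =>
        (∑ a, mellin (f i a) (-((((1 / 2 : ℝ)) : ℂ) + t * I)) • (⟨v a, Submodule.subset_span ⟨a, rfl⟩⟩ : ↥(Submodule.span ℂ (Set.range v)))) +
          qc default ((((1 / 2 : ℝ)) : ℂ) + ((-t : ℝ) : ℂ) * I) •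
            ∑ a, mellin (f i a) (-((((1 / 2 : ℝ)) : ℂ) + ((-t : ℝ) : ℂ) * I)) • (⟨v a, Submodule.subset_span ⟨a, rfl⟩⟩ : ↥(Submodule.span ℂ (Set.range v)))) ∧
      (∀ i, Uiso ⟨∑ a, y i a, mem_topologicalClosure_span (fun i => ∑ a, y i a) i⟩ = WithLp.toLp 2 (r' i, ((Real.sqrt (C * (2 * π)⁻¹) : ℝ) : ℂ) • w i)) := by
  classical
  have hφχ : IsChiSection χ φ := isChiSection_of_mem hφV
  have h𝓕₀ : ν 𝓕 ≠ 0 := by rw [h𝓕1]; exact one_ne_zero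
  -- the letters of ★ `hSD_m1_cm_two` for the sections `c_a•φ`
  have hφK : ∀ k : (quasiSplit (↥(maximalRealSubfield L)) L (IsCMField.complexConj L) 2).Adelic,
      adelicVal (↥(maximalRealSubfield L)) L (IsCMField.complexConj L) 2 ((StdForm.antidiagonal 2).over L) k ∈ standardMaximalCompactGL 2 L → ∀ g, φ (g * k) = φ g :=
    fun k hk g => by simpa only [one_mul] using apply_mul_of_mem hφV g ⟨k, hk⟩
  have haχ : ∀ a, IsChiSection χ (c a • φ) := fun a => hφχ.smul (c a)
  have hac : ∀ a, Continuous (c a • φ) := fun a => hφc.const_smul (c a)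
  have haC : ∀ a, ∃ Cφ : ℝ, ∀ x, ‖(c a • φ) x‖ ≤ Cφ := fun a => ⟨‖c a‖ * Mφ, fun x => by
    rw [Pi.smul_apply, norm_smul]; exact mul_le_mul_of_nonneg_left (hφM x) (norm_nonneg _)⟩
  have haK : ∀ a, ∀ k : (quasiSplit (↥(maximalRealSubfield L)) L (IsCMField.complexConj L) 2).Adelic,
      adelicVal (↥(maximalRealSubfield L)) L (IsCMField.complexConj L) 2 ((StdForm.antidiagonal 2).over L) k ∈ standardMaximalCompactGL 2 L → ∀ g : (quasiSplit (↥(maximalRealSubfield L)) L (IsCMField.complexConj L) 2).Adelic,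
        (c a • φ) (g * k) = (c a • φ) g := fun a k hk g => by rw [Pi.smul_apply, Pi.smul_apply, hφK k hk g]
  have ha1 : ∀ a, (c a • φ) 1 ≠ 0 := fun a => by rw [Pi.smul_apply, smul_eq_mul]; exact mul_ne_zero (hc a) hφ1
  have has : ∀ a, ∀ z : ℂ, 1 < z.re → qc default z = (((((ν 𝓕).toReal⁻¹ : ℝ))) : ℂ) * (((c a • φ) 1)⁻¹ * ∫ u : ↥(adelicUnipotent (↥(maximalRealSubfield L)) L (IsCMField.complexConj L) 2), flatSectionU (c a • φ) z
      (((quasiSplit (↥(maximalRealSubfield L)) L (IsCMField.complexConj L) 2).toAdelic (weylLongU ((IsCMField.complexConj L : L ≃ₐ[↥(maximalRealSubfield L)] L) : L →+* L) (rfl : (StdForm.antidiagonal 2).over L = (StdForm.antidiagonal 2).over L))) * ((u : (quasiSplit (↥(maximalRealSubfield L)) L (IsCMField.complexConj L) 2).Adelic) * 1)) ∂ν) :=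
    fun a z hz => by rw [tube_formula_smul L ν (hc a), hs_tube z hz]
  have hconj : ∀ z : ℂ, 1 < z.re → qc default (conj z) = conj (qc default z) := by
    obtain ⟨cG, hcG⟩ := exists_galTwist_cm L
    have h := chi_scattering_conj_symm_m1_cm_two L hcG ν ((ν 𝓕).toReal⁻¹) hsd hχ hφχ hφK hφ1r hφ1r hPc hPcd hPre (hqa default) hs_tube
    intro z hz
    refine h z (fun hP => ?_) (fun hP => ?_)
    · have := hPre z hP; linarith
    · have := hPre _ hP; rw [Complex.conj_re] at this; linarith
  -- `hB` (★ p861074) and `hSD` (★ p860947) on the clauses, then ★ p861041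
  have hBex := hB_of_package_m1_cm_two L μ νG μK νI h𝓕I ν h𝓕N h𝓕1 h𝓕c hβ hμZ hχ hρ hsd hφV hφc hφM hφinf hφ1 hφ1r hqφ hqNF hE1 hqcq hPc hPcd hPre hqa U hUo hUcod T₀ hT₀ Fam hFd hFam
    hs_tube hσ₀
  have hSDex := hSD_m1_cm_two L μ νG μK νI h𝓕I ν h𝓕N h𝓕c h𝓕₀
  refine hBex.elim fun B hB => hSDex.elim fun C hC => ?_
  have hSD := hC.2 (φ := fun a => c a • φ) (s := qc default) v y hχ hsd haχ hac haC haK ha1 has hconj hf hfs hf0 hσ₀ hv hy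
  refine (exists_linearIsometry_chiSection_selfDual_m1_cm_two_of_package L μ νG μK νI h𝓕I ν h𝓕N h𝓕1 h𝓕c hβ hμZ hχ hρ hsd hφV hφc hφM hφinf hφ1 hφ1r hqφ hqNF hE1 hqcq hPc hPcd hPre
    hqa U hUo hUcod T₀ hT₀ Fam hFd hFam hs_tube v y hf hfs hf0 hσ₀ hB hC.1.le hSD).elim fun S h => h.elim fun ρ h => h.elim fun r' h => h.elim fun w h => h.elim fun Uiso h => ?_
  exact ⟨C, S, ρ, r', w, Uiso, hC.1, h.1, h.2.1, h.2.2.1, h.2.2.2.1, h.2.2.2.2⟩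

/-! ## §3 HEAD: the letter-free print — structural binders only -/

/-- **HEAD — THE PLANCHEREL ISOMETRY OF THE RANK-ONE SELF-DUAL `χ`-BLOCK OF `U(1,1)_{L∕L⁺}` AT THE MAXIMAL LEVEL, LETTER-FREE.**  Binders: the structural data (`μ νG μK νI 𝓕I ν 𝓕 β μZ`);
a self-dual unitary Hecke character `χ` of `L` trivial on `ℝ_{>0}`; the M1 section `φ ∈ V(χ, K_max, 1)` continuous bounded with `φ ∘ ι_∞ = φ(1)` and `φ(1) ≠ 0` real; the rank-one pure
tensors (`c_a ≠ 0`, `v_a =ᵐ (c_a•φ)|_{K_max}`, `f_{i,a} ∈ C²_c((0,∞))`, `y_{i,a} =ᵐ θ_{f_{i,a}, c_a•φ}`); `σ₀ > 1`.  CONCLUSION: `∃ s P C S ρ r′ w U` — `s` THE scattering scalar (Godement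
tube formula, meromorphic in normal form on `ℂ`, analytic off the closed `P ⊆ {Re ≤ 1}`), `C > 0`, `S ⊂ (½, σ₀)` the genuine real poles of `s`, `ρ_c` its residues (real, `≥ 0`),
`⟪r′_i, r′_j⟫ = C·Σ_{c∈S} ⟪Ψ̂_i(−c), ρ_c•Ψ̂_j(−c)⟫_W`, `w_i =ᵐ Ψ̂_i(−(½+it)) + s(½−it)•Ψ̂_i(−(½−it))`, **`U (Σ_a y_{i,a}) = (r′_i, √(C∕2π)•w_i)`** — ★
`chi_scattering_real_poles_m1_complete_cm_two` (the package) ∘ §2. [cite: MoeglinWaldspurger1995, II.2.4, IV.1.10–IV.1.11, IV.3.12] [cite: Langlands1976, §7] [cite: Iwaniec2002, §7.3] -/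
theorem exists_linearIsometry_chiSection_selfDual_m1_letterFree_cm_two
    (μ : Measure (quasiSplit (↥(maximalRealSubfield L)) L (IsCMField.complexConj L) 2).automorphicQuotient) [(quasiSplit (↥(maximalRealSubfield L)) L (IsCMField.complexConj L) 2).IsAutomorphicMeasure μ]
    (νG : Measure (quasiSplit (↥(maximalRealSubfield L)) L (IsCMField.complexConj L) 2).Adelic) [νG.IsHaarMeasure] [νG.IsInvInvariant] [SFinite νG]
    (μK : Measure ↥((standardMaximalCompactGL 2 L).comap (adelicVal (↥(maximalRealSubfield L)) L (IsCMField.complexConj L) 2 ((StdForm.antidiagonal 2).over L)) : Subgroup (quasiSplit (↥(maximalRealSubfield L)) L (IsCMField.complexConj L) 2).Adelic)) [μK.IsHaarMeasure]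
    (νI : Measure (AdeleRing (𝓞 L) L)ˣ) [νI.IsHaarMeasure]
    {𝓕I : Set (AdeleRing (𝓞 L) L)ˣ} (h𝓕I : IsIdeleClassDomain L 𝓕I)
    (ν : Measure ↥(adelicUnipotent (↥(maximalRealSubfield L)) L (IsCMField.complexConj L) 2)) [ν.IsHaarMeasure] [ν.IsMulRightInvariant] [ν.IsInvInvariant]
    {𝓕 : Set ↥(adelicUnipotent (↥(maximalRealSubfield L)) L (IsCMField.complexConj L) 2)} (h𝓕N : IsFundamentalDomain ↥(rationalUnipotent (↥(maximalRealSubfield L)) L (IsCMField.complexConj L) 2) 𝓕 ν) (h𝓕1 : ν 𝓕 = 1)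
    (h𝓕c : IsCompact (closure 𝓕))
    {β : (quasiSplit (↥(maximalRealSubfield L)) L (IsCMField.complexConj L) 2).Adelic → ℝ≥0∞} (hβ : IsCoveringWeight ↥((arithmeticBorel (↥(maximalRealSubfield L)) L (IsCMField.complexConj L) 2).map (quasiSplit (↥(maximalRealSubfield L)) L (IsCMField.complexConj L) 2).arithmeticSubgroup.subtype) β)
    {μZ : Measure (borelQuotient (↥(maximalRealSubfield L)) L (IsCMField.complexConj L) 2)} [SFinite μZ]
    (hμZ : ∀ f : borelQuotient (↥(maximalRealSubfield L)) L (IsCMField.complexConj L) 2 → ℝ≥0∞, Measurable f → ∫⁻ z, f z ∂μZ = ∫⁻ g, β g * f (toBorelQuotient (↥(maximalRealSubfield L)) L (IsCMField.complexConj L) 2 g) ∂νG)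
    {χ : HeckeCharacter L} (hχ : χ.IsUnitary) (hρ : ∀ r : ℝ≥0ˣ, χ (posRealIdele L r) = 1) (hsd : reflectChar (IsCMField.complexConj L) χ = χ)
    {φ : (quasiSplit (↥(maximalRealSubfield L)) L (IsCMField.complexConj L) 2).Adelic → ℂ} (hφV : φ ∈ chiSectionSpace χ ((standardMaximalCompactGL 2 L).comap (adelicVal (↥(maximalRealSubfield L)) L (IsCMField.complexConj L) 2 ((StdForm.antidiagonal 2).over L)) : Subgroup (quasiSplit (↥(maximalRealSubfield L)) L (IsCMField.complexConj L) 2).Adelic) (fun _ => 1)) (hφc : Continuous φ) {Mφ : ℝ} (hφM : ∀ x, ‖φ x‖ ≤ Mφ)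
    (hφinf : ∀ a : arch (↥(maximalRealSubfield L)) L (IsCMField.complexConj L) 2 ((StdForm.antidiagonal 2).over L), φ (archToAdelic (↥(maximalRealSubfield L)) L (IsCMField.complexConj L) 2 _ a) = φ 1)
    (hφ1 : φ 1 ≠ 0) (hφ1r : conj (φ 1) = φ 1)
    {ι α : Type*} [Fintype α] (c : α → ℂ) (hc : ∀ a, c a ≠ 0)
    (v : α → Lp ℂ 2 μK) (hv : ∀ a, ((v a : Lp ℂ 2 μK) : ↥((standardMaximalCompactGL 2 L).comap (adelicVal (↥(maximalRealSubfield L)) L (IsCMField.complexConj L) 2 ((StdForm.antidiagonal 2).over L)) : Subgroup (quasiSplit (↥(maximalRealSubfield L)) L (IsCMField.complexConj L) 2).Adelic) → ℂ) =ᵐ[μK]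
      fun k => (c a • φ) (k : (quasiSplit (↥(maximalRealSubfield L)) L (IsCMField.complexConj L) 2).Adelic))
    {f : ι → α → ℝ → ℂ} (hf : ∀ i a, ContDiff ℝ 2 (f i a)) (hfs : ∀ i a, HasCompactSupport (f i a)) (hf0 : ∀ i a, tsupport (f i a) ⊆ Ioi 0)
    (y : ι → α → Lp ℂ 2 μ) (hy : ∀ i a, ((y i a : Lp ℂ 2 μ) : (quasiSplit (↥(maximalRealSubfield L)) L (IsCMField.complexConj L) 2).automorphicQuotient → ℂ) =ᵐ[μ]
      (quasiSplit (↥(maximalRealSubfield L)) L (IsCMField.complexConj L) 2).quotFun (eisensteinSeriesU (fun g : (quasiSplit (↥(maximalRealSubfield L)) L (IsCMField.complexConj L) 2).Adelic => f i a (borelHeight g : ℝ) * (c a • φ) g)))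
    {σ₀ : ℝ} (hσ₀ : 1 < σ₀) :
    ∃ (s : ℂ → ℂ) (P : Set ℂ) (C : ℝ) (S : Finset ℝ) (ρ : ℝ → ℂ) (r' : ι → PiLp 2 (fun _ : ↥S => ↥(Submodule.span ℂ (Set.range v))))
      (w : ι → Lp ↥(Submodule.span ℂ (Set.range v)) 2 ((volume : Measure ℝ).restrict (Ioi 0)))
      (Uiso : (Submodule.span ℂ (Set.range fun i => ∑ a, y i a)).topologicalClosure →ₗᵢ[ℂ]
        WithLp 2 (PiLp 2 (fun _ : ↥S => ↥(Submodule.span ℂ (Set.range v))) × Lp ↥(Submodule.span ℂ (Set.range v)) 2 ((volume : Measure ℝ).restrict (Ioi 0)))),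
      (∀ z : ℂ, 1 < z.re → s z = (((ν 𝓕).toReal⁻¹ : ℝ) : ℂ) * ((φ 1)⁻¹ * ∫ u : ↥(adelicUnipotent (↥(maximalRealSubfield L)) L (IsCMField.complexConj L) 2), flatSectionU φ z
        ((quasiSplit (↥(maximalRealSubfield L)) L (IsCMField.complexConj L) 2).toAdelic (weylLongU (IsCMField.complexConj L : L →+* L)
          (rfl : (StdForm.antidiagonal 2).over L = (StdForm.antidiagonal 2).over L)) * ((u : (quasiSplit (↥(maximalRealSubfield L)) L (IsCMField.complexConj L) 2).Adelic) * 1)) ∂ν)) ∧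
      MeromorphicNFOn s univ ∧ IsClosed P ∧ (∀ z ∈ P, z.re ≤ 1) ∧ (∀ z : ℂ, z ∉ P → AnalyticAt ℂ s z) ∧
      0 < C ∧
      (∀ c ∈ S, ¬ AnalyticAt ℂ s (c : ℂ) ∧ 1 / 2 < c ∧ c < σ₀) ∧
      (∀ c ∈ S, Tendsto (fun z : ℂ => (z - c) * s z) (𝓝[≠] (c : ℂ)) (𝓝 (ρ c)) ∧ (ρ c).im = 0 ∧ 0 ≤ (ρ c).re) ∧
      (∀ i j, ⟪r' i, r' j⟫_ℂ = (C : ℂ) * ∑ c ∈ S, ⟪∑ b, mellin (f i b) (-(c : ℂ)) • (⟨v b, Submodule.subset_span ⟨b, rfl⟩⟩ : ↥(Submodule.span ℂ (Set.range v))),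
        ρ c • ∑ a, mellin (f j a) (-(c : ℂ)) • (⟨v a, Submodule.subset_span ⟨a, rfl⟩⟩ : ↥(Submodule.span ℂ (Set.range v)))⟫_ℂ) ∧
      (∀ i, (w i : ℝ → ↥(Submodule.span ℂ (Set.range v))) =ᵐ[(volume : Measure ℝ).restrict (Ioi 0)] fun t =>
        (∑ a, mellin (f i a) (-((((1 / 2 : ℝ)) : ℂ) + t * I)) • (⟨v a, Submodule.subset_span ⟨a, rfl⟩⟩ : ↥(Submodule.span ℂ (Set.range v)))) +
          s ((((1 / 2 : ℝ)) : ℂ) + ((-t : ℝ) : ℂ) * I) •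
            ∑ a, mellin (f i a) (-((((1 / 2 : ℝ)) : ℂ) + ((-t : ℝ) : ℂ) * I)) • (⟨v a, Submodule.subset_span ⟨a, rfl⟩⟩ : ↥(Submodule.span ℂ (Set.range v)))) ∧
      (∀ i, Uiso ⟨∑ a, y i a, mem_topologicalClosure_span (fun i => ∑ a, y i a) i⟩ = WithLp.toLp 2 (r' i, ((Real.sqrt (C * (2 * π)⁻¹) : ℝ) : ℂ) • w i)) := by
  classical
  -- ONE `obtain` of the package (★ `chi_scattering_real_poles_m1_complete_cm_two`), by `Exists.elim` and projections (the goal is large)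
  have hpk := chi_scattering_real_poles_m1_complete_cm_two L μ νG μK νI h𝓕I ν h𝓕N h𝓕1 h𝓕c hβ hμZ hχ hρ hsd hφV hφc hφM hφinf hφ1 hφ1r
  refine hpk.elim fun bV h => h.elim fun q h => h.elim fun Ec h => h.elim fun qc h => h.elim fun P h => ?_
  have hbV := h.1
  have hcl := h.2.1
  have hs_tube := h.2.2.1
  have hqφ : ∀ z : ℂ, 1 < z.re → (∑ j, q j z • φ) = ((((ν 𝓕).toReal⁻¹ : ℝ)) : ℂ) • (fun g : (quasiSplit (↥(maximalRealSubfield L)) L (IsCMField.complexConj L) 2).Adelic => (∫ v : ↥(adelicUnipotent (↥(maximalRealSubfield L)) L (IsCMField.complexConj L) 2), flatSectionU φ z ((quasiSplit (↥(maximalRealSubfield L)) L (IsCMField.complexConj L) 2).toAdelic (weylLongU ((IsCMField.complexConj L : L ≃ₐ[↥(maximalRealSubfield L)] L) : L →+* L) (rfl : (StdForm.antidiagonal 2).over L = (StdForm.antidiagonal 2).over L)) * ((v : (quasiSplit (↥(maximalRealSubfield L)) L (IsCMField.complexConj L) 2).Adelic) * g)) ∂ν) * (((borelHeight g : ℝ)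 : ℂ) ^ (z - 1))) := fun z hz => by
    rw [← hcl.2.1 z hz]
    exact Finset.sum_congr rfl fun j _ => by rw [hbV j]
  have hqNF := hcl.2.2.2.1
  have hE1 := hcl.2.2.2.2.1
  have hqcq := hcl.2.2.2.2.2.1
  have hPc := hcl.2.2.2.2.2.2.1
  have hPcd := hcl.2.2.2.2.2.2.2.1
  have hPre := hcl.2.2.2.2.2.2.2.2.1
  have hqa := hcl.2.2.2.2.2.2.2.2.2.2.1
  have hF := hcl.2.2.2.2.2.2.2.2.2.2.2.2.2.2
  -- skolemise the per-ball families
  choose U hU using hF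
  choose T₀ hT using fun n => (hU n).2.2.2
  choose Fam hFam using fun n => (hT n).2
  refine (exists_linearIsometry_chiSection_selfDual_m1_rankOne_of_package L μ νG μK νI h𝓕I ν h𝓕N h𝓕1 h𝓕c hβ hμZ hχ hρ hsd hφV hφc hφM hφinf hφ1 hφ1r hqφ hqNF hE1 hqcq hPc hPcd
    hPre hqa U (fun n => (hU n).1) (fun n => (hU n).2.2.1) T₀ (fun n => (hT n).1) Fam (fun n => (hFam n).1) (fun n => (hFam n).2) hs_tube c hc v hv hf hfs hf0 y hy hσ₀).elim
    fun C h => h.elim fun S h => h.elim fun ρ h => h.elim fun r' h => h.elim fun w h => h.elim fun Uiso h => ?_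
  exact ⟨qc default, P, C, S, ρ, r', w, Uiso, hs_tube, hqNF default, hPc, hPre, hqa default, h.1, h.2.1, h.2.2.1, h.2.2.2.1, h.2.2.2.2.1, h.2.2.2.2.2⟩

end Summit.HodgeConjecture.HodgeConjecture.Cruxes.H413.K2E1ChiSectionPlancherelSelfDualM1CMTwoLetterFree

end
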